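import Literature.NumberTheory.IwasawaTheory.UnramifiedHomsZpTowerFinite
import Literature.NumberTheory.EllipticCurves.FineSelmerTrivialisingRestrictionProofs
import Literature.NumberTheory.EllipticCurves.FineSelmerCongruentCurvesNumberFieldProofs
import Literature.NumberTheory.EllipticCurves.DivisionField
import Literature.NumberTheory.EllipticCurves.ZpExtensionRestrictLayerCompositum
import Literature.NumberTheory.EllipticCurves.ZpExtensionRestrictCyclotomic
import Literature.NumberTheory.EllipticCurves.ZpExtensionRestrictShift
import Literature.NumberTheory.IwasawaTheory.ClassicalMuInvariant
import HarnessLib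

/-!
# Coates–Sujatha 2005, Thm. 3.4 in bounded-`p`-rank form: statement (A) for `E` at an odd `p` over the cyclotomic
# `ℤ_p`-extension from BOUNDED `p`-RANKS of the class groups along the cyclotomic tower of `K(E[p])` (proved)

`Proofs`-style file (theorems only: no definition, no named fact, no `sorry`) in topic `NumberTheory/EllipticCurves`,
namespace `Literature.NumberTheory.EllipticCurves.CoatesSujatha2005` (that of the named fact
`thm34_fineSelmerDual_moduleFinite_of_classicalMuVanishes_divisionField`, file `FineSelmerClassGroupCriterion`), written by
the prover seat `bsd-potss-k8t-c4` g21 (cell `bsd-potss`, K8-t′ route, item stmt-BirchSwinnertonDyer-19982; closes nothing).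

THE THEOREM (`fineSelmerDual_moduleFinite_of_classGroupPRank_le`). `K` a number field, `E = W/K` elliptic, `p` odd,
`κ` the cyclotomic `ℤ_p`-extension of `K`, `L = K(E[p])` (`W.divisionField p`): if for ONE (equivalently every) cyclotomic `ℤ_p`-extension `κ_L` of `L` the `p`-ranks
`rank_p Cl(L_m)` (`IwasawaTheory.classGroupPRank κ_L m`) are BOUNDED in `m`, then statement (A) holds for `E` at `p`
over `K_∞` — the dual fine Selmer group is finitely generated over `ℤ_p` (`∃ γ D, Module.Finite ℤ_[p] D.X`, the tree's
spelling).  This is the form of Coates–Sujatha's Thm. 3.4 («`μ_class(L_cyc) = 0 ⟹` (A)», proof via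
`H²(𝒪_{L_∞}[1/S], ℤ/p) = 0`, Kurihara–Pollack 2007 §3.1) that the class-group μ-road doors of `FineSelmerMuRoadDoors`
actually deliver: Iwasawa 1956 (`e_m = 0` for all `m`), Fukuda 1994 Thm. 1 (1) (`e_m` constant) and (2) (`rank` constant)
all give BOUNDED `p`-ranks — and all three are tree theorems — whereas the growth form `ClassicalMuVanishes` ⟹ bounded
ranks is Iwasawa's structure theory (named fact `iwasawa1959_classNumberPExp_growth`).

Proof: (A) ⟺ `Sel₀(K_∞, E[p])` finite (Lim–Sujatha, tree `fineSelmerDual_moduleFinite_iff_finite_fineSelmerInfty_torsion`)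
⟸ `Hom(Gal(K̄/L·K_∞), E[p]; ∅)` finite (`FineSelmerTrivialisingRestriction.finite_fineSelmerInfty_of_finite_unramifiedHoms`)
⟸ `[Cl(L·K_n) : Cl(L·K_n)^p]` bounded (`UnramifiedHomsZpTowerFinite.unramifiedHoms_finite_of_index_le`), and
`L·K_n = K̄^{Γ_L ∩ κ⁻¹(pⁿℤ_p)}` is a layer of the (shifted) base change of `κ` to `L`
(`ZpExtension.nonempty_ringEquiv_layer_fieldRange_sup_layer_of_layerSubgroup_eq`), whose `[Cl : Cl^p] = p^{rank_p}`.

* §1 `fineSelmerDual_moduleFinite_of_index_le` — general form over the subgroups `Γ_{K(M)} ∩ κ⁻¹(pⁿℤ_p)`.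
* §2 `fixedField_inf_layerSubgroup_eq` — `K̄^{Γ_{K(E[p])} ∩ κ⁻¹(pⁿℤ_p)} = K(E[p]) ⊔ K_n`;
  `classGroupPRank_eq_of_isCyclotomic` — the `p`-ranks do not depend on the normalisation of the cyclotomic tower.
* §3 `fineSelmerDual_moduleFinite_of_classGroupPRank_le`, `…_of_forall_classGroupPRank_le` — the theorem (no hypothesis on
  `K(E[p]) ∩ K_∞`: shifted base change `ZpExtension.exists_zpExtension_shift`).

References: [CoatesSujatha2005] Thm. 3.4; [KuriharaPollack2007] §3.1; [LimSujatha2018] §3; [Washington1997] §13.1, §13.3;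
[RaySujatha2021] Thm. 2.3.
-/

set_option autoImplicit false

noncomputable section

open scoped Classical NumberField
open NumberField IsDedekindDomain Field IntermediateField

namespace Literature.NumberTheory.EllipticCurves.CoatesSujatha2005

open WeierstrassCurve Literature.NumberTheory.IwasawaTheory Literature.NumberTheory.GaloisRepresentations
  Literature.NumberTheory.EllipticCurves Literature.NumberTheory.EllipticCurves.GreenbergSelmer
  Literature.NumberTheory.EllipticCurves.ZpExtension

variable {K : Type} [Field K] [NumberField K] (W : WeierstrassCurve K) [W.IsElliptic] {p : ℕ} [Fact p.Prime]

/-! ## §1 Statement (A) from bounded `[Cl : Cl^p]` along the tower `K(E[p])·K_n` -/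

/-- **Statement (A) from bounded indices `[Cl(K(E[p])·K_n) : Cl(K(E[p])·K_n)^p]`** (general form). For `E = W`
elliptic over a number field `K`, `p` odd, `κ` the cyclotomic `ℤ_p`-extension of `K`: if the index of the `p`-th powers
in the class group of `K̄^{Γ_{K(E[p])} ∩ κ⁻¹(pⁿℤ_p)} = K(E[p])·K_n` is `≤ C` for every `n`, then the dual fine Selmer
group of `E` over `K_∞` is finitely generated over `ℤ_p`.
[cite: CoatesSujatha2005, Thm. 3.4] [cite: KuriharaPollack2007, §3.1] [cite: LimSujatha2018, §3 (lemma before Prop. 3.2)] -/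
theorem fineSelmerDual_moduleFinite_of_index_le (hp : p ≠ 2) (κ : ZpExtension K p) (hκ : κ.IsCyclotomic) (C : ℕ)
    (hC : ∀ n : ℕ, (powMonoidHom p :
        ClassGroup (𝓞 (fixedField (fixingSubgroupOfModule K ↥(W.geomTorsion (p : ℤ)) ⊓ κ.layerSubgroup n) :
          IntermediateField K (AlgebraicClosure K))) →*
        ClassGroup (𝓞 (fixedField (fixingSubgroupOfModule K ↥(W.geomTorsion (p : ℤ)) ⊓ κ.layerSubgroup n) :
          IntermediateField K (AlgebraicClosure K)))).range.index ≤ C) :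
    ∃ (γ : absoluteGaloisGroup K) (D : W.FineSelmerDualData κ γ),
      Module.Finite ℤ_[p] (RestrictScalars ℤ_[p] (IwasawaAlgebra p) D.X) := by
  have hpr : p.Prime := Fact.out
  haveI : NeZero p := ⟨hpr.ne_zero⟩
  haveI : Finite ↥(W.geomTorsion (p : ℤ)) := W.finite_geomTorsion_nat hpr.ne_zero
  haveI : ContinuousSMul (absoluteGaloisGroup K) ↥(W.geomTorsion (p : ℤ)) :=
    WeierstrassCurve.continuousSMul_geomTorsion W (WeierstrassCurve.isOpen_stabilizer_point_holds W) (p : ℤ)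
  haveI : (fixingSubgroupOfModule K ↥(W.geomTorsion (p : ℤ))).Normal := W.fixingSubgroupOfModule_geomTorsion_normal p
  have hN : IsOpen (fixingSubgroupOfModule K ↥(W.geomTorsion (p : ℤ)) : Set (absoluteGaloisGroup K)) :=
    W.isOpen_fixingSubgroupOfModule_geomTorsion p
  have hpM : ∀ m : ↥(W.geomTorsion (p : ℤ)), p • m = 0 := fun m =>
    Subtype.ext (by
      rw [AddSubmonoidClass.coe_nsmul, ZeroMemClass.coe_zero]
      exact AddSubgroup.torsionBy.nsmul_iff.mp m.2)
  rw [LimSujatha2018.fineSelmerDual_moduleFinite_iff_finite_fineSelmerInfty_torsion W hp κ hκ]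
  exact FineSelmerTrivialisingRestriction.finite_fineSelmerInfty_of_finite_unramifiedHoms κ
    (UnramifiedHomsZpTowerFinite.unramifiedHoms_finite_of_index_le κ _ hN hp _ hpM C hC)

/-! ## §2 The layers `K(E[p])·K_n` and the independence of the normalisation -/

omit [NumberField K] in
/-- `K̄^{Γ_{K(E[p])} ∩ κ⁻¹(pⁿℤ_p)} = K(E[p]) ⊔ K_n` inside `K̄` (both have the same open fixing subgroup; Krull–Galois
correspondence `InfiniteGalois.fixedField_fixingSubgroup`). [cite: Washington1997, §13.1 (the layers `LK_n` of `LK_∞/L`)] -/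
theorem fixedField_inf_layerSubgroup_eq [CharZero K] [NeZero p] (κ : ZpExtension K p) (n : ℕ) :
    (fixedField (fixingSubgroupOfModule K ↥(W.geomTorsion (p : ℤ)) ⊓ κ.layerSubgroup n) :
        IntermediateField K (AlgebraicClosure K)) = W.divisionField p ⊔ κ.layer n := by
  haveI : Algebra.IsAlgebraic K (AlgebraicClosure K) := AlgebraicClosure.isAlgebraic K
  haveI : IsGalois K (AlgebraicClosure K) := {}
  set E : IntermediateField K (AlgebraicClosure K) :=
    fixedField (fixingSubgroupOfModule K ↥(W.geomTorsion (p : ℤ)) ⊓ κ.layerSubgroup n) with hE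
  have hopen : IsOpen ((fixingSubgroupOfModule K ↥(W.geomTorsion (p : ℤ)) ⊓ κ.layerSubgroup n :
      Subgroup (absoluteGaloisGroup K)) : Set (absoluteGaloisGroup K)) :=
    (W.isOpen_fixingSubgroupOfModule_geomTorsion p).inter (κ.isOpen_layerSubgroup n)
  have h1 : E.fixingSubgroup = fixingSubgroupOfModule K ↥(W.geomTorsion (p : ℤ)) ⊓ κ.layerSubgroup n :=
    fixingSubgroup_fixedField_of_isOpen _ hopen
  -- the fixing subgroup of `K(E[p]) ⊔ K_n`
  have hmap : ∀ H : Subgroup (absoluteGaloisGroup K),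
      H.map (absoluteGaloisGroup.toAlgEquiv K).toMonoidHom = H := by
    intro H
    ext x
    constructor
    · rintro ⟨y, hy, rfl⟩; exact hy
    · intro hx; exact ⟨x, hx, rfl⟩
  have h2 : (W.divisionField p ⊔ κ.layer n).fixingSubgroup =
      fixingSubgroupOfModule K ↥(W.geomTorsion (p : ℤ)) ⊓ κ.layerSubgroup n := by
    rw [IntermediateField.fixingSubgroup_sup, W.fixingSubgroup_divisionField p, κ.fixingSubgroup_layer n, hmap]
    rfl
  rw [← InfiniteGalois.fixedField_fixingSubgroup E, ← InfiniteGalois.fixedField_fixingSubgroup (W.divisionField p ⊔ κ.layer n),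
    h1, h2]

omit [NumberField K] in
/-- Two cyclotomic `ℤ_p`-extensions of the same field have the same `rank_p Cl` at every layer (they differ by a unit
twist, `IsCyclotomic.exists_eq_unitTwist_holds`, which does not move the layers, `layer_unitTwist`).
[cite: Washington1997, §13.1] -/
theorem classGroupPRank_eq_of_isCyclotomic {F : Type} [Field F] (κ₁ κ₂ : ZpExtension F p)
    (h₁ : κ₁.IsCyclotomic) (h₂ : κ₂.IsCyclotomic) (m : ℕ) :
    classGroupPRank κ₁ m = classGroupPRank κ₂ m := by
  obtain ⟨u, hu⟩ := ZpExtension.IsCyclotomic.exists_eq_unitTwist_holds h₁ h₂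
  rw [hu]
  exact (congrArg (fun E : IntermediateField F (AlgebraicClosure F) =>
    padicValNat p (Nat.card (ClassGroup (𝓞 ↥E) ⧸ (powMonoidHom p : ClassGroup (𝓞 ↥E) →* _).range)))
    (κ₁.layer_unitTwist u m)).symm

/-- `[Cl : Cl^p]` is invariant under isomorphism of class groups. [folklore] -/
private theorem index_range_pow_eq_of_mulEquiv {G H : Type*} [CommGroup G] [CommGroup H] (e : G ≃* H) (q : ℕ) :
    (powMonoidHom q : H →* H).range.index = (powMonoidHom q : G →* G).range.index := by
  have hmap : (powMonoidHom q : G →* G).range.map e.toMonoidHom = (powMonoidHom q : H →* H).range := by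
    ext h
    constructor
    · rintro ⟨x, ⟨y, rfl⟩, rfl⟩
      exact ⟨e y, by rw [powMonoidHom_apply, powMonoidHom_apply, MulEquiv.coe_toMonoidHom, map_pow]⟩
    · rintro ⟨y, rfl⟩
      refine ⟨e.symm y ^ q, ⟨e.symm y, rfl⟩, ?_⟩
      rw [powMonoidHom_apply, MulEquiv.coe_toMonoidHom, map_pow, MulEquiv.apply_symm_apply]
  rw [← hmap, Subgroup.index_map_of_bijective e.bijective]

/-- `[Cl(K_m) : Cl(K_m)^p] = p ^ rank_p Cl(K_m)` for the layers of a `ℤ_p`-extension of a number field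
(the index is a `p`-power, tree `index_range_powMonoidHom_eq_prime_pow`). [cite: Fukuda1994, p. 264 (definition of `rank(M)`)] -/
theorem index_range_pow_layer_eq {F : Type} [Field F] [NumberField F] (κF : ZpExtension F p) (m : ℕ) :
    (powMonoidHom p : ClassGroup (𝓞 ↥(κF.layer m)) →* ClassGroup (𝓞 ↥(κF.layer m))).range.index =
      p ^ classGroupPRank κF m := by
  haveI : FiniteDimensional F (κF.layer m) := κF.finiteDimensional_layer_holds m
  haveI : NumberField (κF.layer m) := NumberField.of_module_finite F (κF.layer m)
  obtain ⟨c, hc⟩ := NumberFields.index_range_powMonoidHom_eq_prime_pow (K := ↥(κF.layer m)) p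
  rw [classGroupPRank_def, ← Subgroup.index_eq_card, hc, padicValNat.prime_pow]

/-! ## §3 Statement (A) from bounded `p`-ranks along the cyclotomic tower of `K(E[p])` -/

omit [NumberField K] in
/-- For the shifted base change `κ'` of `κ` to `M` (`p^a κ' = κ ∘ res`, tree `exists_zpExtension_shift`), EVERY layer
subgroup `κ⁻¹(pⁿℤ_p)` of `κ` pulls back to a layer subgroup of `κ'`: the `(n-a)`-th if `a ≤ n`, the `0`-th (all of `Γ_M`,
as `res Γ_M ⊆ κ⁻¹(p^a ℤ_p) ⊆ κ⁻¹(pⁿℤ_p)`) if `n ≤ a` — the layers of `M·K_∞/M` are the `M·K_n`, `n ≥ a`, and `M·K_n = M`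
for `n ≤ a`. [cite: Washington1997, §13.1] -/
theorem exists_layerSubgroup_eq_comap_of_shift (κ : ZpExtension K p) (M : Type) [Field M] [Algebra K M]
    {a : ℕ} (κ' : ZpExtension M p)
    (hs : ∀ σ : absoluteGaloisGroup M, (p : ℤ_[p]) ^ a * (κ' σ).toAdd = (κ (absGaloisRestrict K M σ)).toAdd)
    (n : ℕ) : ∃ m : ℕ, κ'.layerSubgroup m = (κ.layerSubgroup n).comap (absGaloisRestrict K M).toMonoidHom := by
  by_cases han : a ≤ n
  · refine ⟨n - a, ?_⟩
    have := layerSubgroup_eq_comap_of_shift κ M κ' hs (n - a)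
    rwa [Nat.sub_add_cancel han] at this
  · refine ⟨0, ?_⟩
    have h0 := layerSubgroup_eq_comap_of_shift κ M κ' hs 0
    rw [zero_add] at h0
    rw [κ'.layerSubgroup_zero] at h0 ⊢
    refine le_antisymm (fun τ _ => ?_) le_top
    have hτ : τ ∈ (κ.layerSubgroup a).comap (absGaloisRestrict K M).toMonoidHom := by rw [← h0]; exact Subgroup.mem_top τ
    rw [Subgroup.mem_comap] at hτ ⊢
    exact κ.layerSubgroup_antitone (le_of_not_ge han) hτ

/-- **Coates–Sujatha 2005, Thm. 3.4, bounded-`p`-rank form (PROVED).** `E = W` elliptic over a number field `K`, `p` odd,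
`κ` the cyclotomic `ℤ_p`-extension of `K`, `L = K(E[p])`. If some cyclotomic `ℤ_p`-extension `κ_L` of `L` has
`rank_p Cl(L_m) ≤ B` for every layer `m`, then statement (A) holds for `E` at `p`: the dual fine Selmer group over `K_∞` is
finitely generated over `ℤ_p`. (Printed: «`μ_p(F_cyc/F) = 0 ⟹ μ^{fine}_p(E/F_cyc) = 0`», `F = ℚ(E[p])`; here the input is
the bounded-rank consequence of `μ = 0` that the tree's class-number doors produce. NO hypothesis on `L ∩ K_∞`: the layers
`L·K_n` of the tower are read through the shifted base change `exists_zpExtension_shift`.)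
[cite: CoatesSujatha2005, Thm. 3.4] [cite: RaySujatha2021, Thm. 2.3] [cite: KuriharaPollack2007, §3.1] -/
theorem fineSelmerDual_moduleFinite_of_classGroupPRank_le (hp : p ≠ 2) (κ : ZpExtension K p) (hκ : κ.IsCyclotomic)
    (B : ℕ)
    (hB : haveI : NeZero p := ⟨(Fact.out : p.Prime).ne_zero⟩
      ∃ κL : ZpExtension ↥(W.divisionField p) p, κL.IsCyclotomic ∧ ∀ m, classGroupPRank κL m ≤ B) :
    ∃ (γ : absoluteGaloisGroup K) (D : W.FineSelmerDualData κ γ),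
      Module.Finite ℤ_[p] (RestrictScalars ℤ_[p] (IwasawaAlgebra p) D.X) := by
  have hpr : p.Prime := Fact.out
  haveI : NeZero p := ⟨hpr.ne_zero⟩
  set L : IntermediateField K (AlgebraicClosure K) := W.divisionField p with hLdef
  haveI : NumberField L := NumberField.of_module_finite K L
  obtain ⟨κL, hκL, hBκL⟩ := hB
  -- the shifted base change `κ'` of `κ` to `L` is cyclotomic, so has the same `p`-ranks as `κL`
  obtain ⟨a, κ', hs⟩ := exists_zpExtension_shift κ (↥L)
  have hκ' : κ'.IsCyclotomic := isCyclotomic_of_shift κ (↥L) κ' hs hκ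
  refine fineSelmerDual_moduleFinite_of_index_le W hp κ hκ (p ^ B) fun n => ?_
  -- `K(E[p])·K_n ≅ κ'.layer m`
  obtain ⟨m, hnm⟩ := exists_layerSubgroup_eq_comap_of_shift κ (↥L) κ' hs n
  obtain ⟨e⟩ := nonempty_ringEquiv_layer_fieldRange_sup_layer_of_layerSubgroup_eq κ (↥L) κ' hnm L.val
  have hfield : (L.val.fieldRange ⊔ κ.layer n) =
      fixedField (fixingSubgroupOfModule K ↥(W.geomTorsion (p : ℤ)) ⊓ κ.layerSubgroup n) := by
    rw [IntermediateField.fieldRange_val, hLdef, fixedField_inf_layerSubgroup_eq W κ n]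
  let e' : ↥(κ'.layer m) ≃+* ↥(fixedField (fixingSubgroupOfModule K ↥(W.geomTorsion (p : ℤ)) ⊓ κ.layerSubgroup n) :
      IntermediateField K (AlgebraicClosure K)) :=
    e.trans (IntermediateField.equivOfEq hfield).toRingEquiv
  have hidx := index_range_pow_eq_of_mulEquiv (ClassGroup.mulEquiv (RingOfIntegers.mapRingEquiv e')) p
  rw [hidx, index_range_pow_layer_eq κ' m, classGroupPRank_eq_of_isCyclotomic κ' κL hκ' hκL m]
  exact Nat.pow_le_pow_right hpr.pos (hBκL m)

/-- **The same with the bound asked of EVERY cyclotomic `ℤ_p`-extension of `K(E[p])`** — the hypothesis shape of the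
class-group doors of `FineSelmerMuRoadDoors` (a cyclotomic `ℤ_p`-extension of `K(E[p])` exists: the shifted base change).
[cite: CoatesSujatha2005, Thm. 3.4] [cite: RaySujatha2021, Thm. 2.3] -/
theorem fineSelmerDual_moduleFinite_of_forall_classGroupPRank_le (hp : p ≠ 2) (B : ℕ)
    (hB : haveI : NeZero p := ⟨(Fact.out : p.Prime).ne_zero⟩
      ∀ κL : ZpExtension ↥(W.divisionField p) p, κL.IsCyclotomic → ∀ m, classGroupPRank κL m ≤ B)
    (κ : ZpExtension K p) (hκ : κ.IsCyclotomic) :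
    ∃ (γ : absoluteGaloisGroup K) (D : W.FineSelmerDualData κ γ),
      Module.Finite ℤ_[p] (RestrictScalars ℤ_[p] (IwasawaAlgebra p) D.X) := by
  have hpr : p.Prime := Fact.out
  haveI : NeZero p := ⟨hpr.ne_zero⟩
  haveI : NumberField (W.divisionField p) := NumberField.of_module_finite K _
  obtain ⟨a, κ', hs⟩ := exists_zpExtension_shift κ ↥(W.divisionField p)
  have hκ' : κ'.IsCyclotomic := isCyclotomic_of_shift κ _ κ' hs hκ
  exact fineSelmerDual_moduleFinite_of_classGroupPRank_le W hp κ hκ B ⟨κ', hκ', hB κ' hκ'⟩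

end Literature.NumberTheory.EllipticCurves.CoatesSujatha2005

end
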